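import Summits.AtomisticToContinuum.Crystallization.Theorems.FrustratedLawDichotomyStrainedPatchHomSlopePathThird

/-!
# The SHARP (radially split) two-sided third-order expansion of the per-label slope form
# (27623 `(H) HomFloor (1/625)`, hcp half; the «sharp per-label rem3» lever of hand-1 g35 §3c / g36 R3(iii), critic rows 1368 (2) / 1408 (4))

decomp-a2c hand-1 g37 (crux `AperiodicFrustratedLawGap`, stmt-AtomisticToContinuum-27623).  `…HomSlopePathThird.slopeForm_thirdOrder` bounds the
third-order Taylor remainder of `g(s) = B(ρ_s)⟪p + s d, Δ⟫` by `(K/6)‖d‖³‖Δ‖` with ONE isotropic constant `K ≥ |B₃|ρ + 6|B₂| + 6|B₁|/ρ`.  For the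
Lennard-Jones profile at the first shell `|B₃|ρ ≈ |α″ρ²| ≫ |B₂|, |B₁|/ρ`, and `B₃` multiplies `σ³` only, `σ = ρ′ = ⟪p + s d, d⟫/ρ_s` — the RADIAL
component of the displacement `d`, which on an entry box is certified well below `‖d‖` (`|σ| ≤ A := min(‖d‖, (sup|⟪p,d⟫| + ‖d‖²)/a)`).  This module
is the real side of the sharpened kernel remainder:

* §1 ★ `thirdDeriv_abs_le_sharp`: with `|σ| ≤ A`, `0 ≤ τ ≤ nd²/ρ`, `|τ′| ≤ 3nd³/ρ²`, `|u| ≤ ρ nΔ`, `|m| ≤ nd nΔ` and SEPARATE constants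
  `|B₃|ρ ≤ K₃`, `|B₂| ≤ K₂`, `|B₁|/ρ ≤ K₁`:  `|g‴| ≤ (K₃A³ + 3K₂(A nd² + A² nd) + 6K₁ nd³)·nΔ` (at `A = nd` this is `(K₃ + 6K₂ + 6K₁) nd³ nΔ`, the
  isotropic bound of record);
* §2 ★ `abs_segS_le_of_inner_le`: `|σ_t| ≤ (P + ‖d‖²)/a` on `[0,1]` from `|⟪p,d⟫| ≤ P` and the tube floor `a ≤ ρ_t`;
* §3 ★★★ `slopeForm_thirdOrder_sharp`: the two-sided expansion with the closed-form first/second-order terms of `slopeForm_thirdOrder` VERBATIM and the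
  remainder `(K₃A³ + 3K₂(A‖d‖² + A²‖d‖) + 6K₁‖d‖³)/6 · ‖Δ‖`.

NO definitions; 0 sorry; standard axioms; no instances / notation / `#eval`.  `--supports stmt-AtomisticToContinuum-27623`.  [folklore: Taylor with third-order
remainder, radial/tangential split of the path derivatives]
-/

noncomputable section

namespace Summit.AtomisticToContinuum.Crystallization.Theorems.FrustratedLawDichotomyStrainedPatchHomSlopePathThirdSharp

open scoped RealInnerProductSpace
open Summit.AtomisticToContinuum.Crystallization.Theorems.FrustratedLawDichotomyStrainedPatchTaylorChord
  (segR segN segS segN_eq_inner hasDerivAt_segR hasDerivAt_segS segS_sq_le)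
open Summit.AtomisticToContinuum.Crystallization.Theorems.FrustratedLawDichotomyStrainedPatchHomHessPath
  (inner_path_eq hasDerivAt_inner_path abs_segS_le segS_deriv_eq segS_deriv_bounds)
open Summit.AtomisticToContinuum.Crystallization.Theorems.FrustratedLawDichotomyStrainedPatchHomSlopePath
  (hasDerivAt_slopeForm hasDerivAt_slopeForm_deriv)
open Summit.AtomisticToContinuum.Crystallization.Theorems.FrustratedLawDichotomyStrainedPatchHomSlopePathThird
  (taylor3_abs abs_tau_deriv_le hasDerivAt_slopeForm_deriv2)

/-! ## §1. The radially split pointwise bound of `g‴` -/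

/-- ★ **Pointwise bound of the third derivative, radial split**: `|σ| ≤ A`, `0 ≤ τ ≤ nd²/ρ`, `|τ′| ≤ 3nd³/ρ²`, `|u| ≤ ρ nΔ`, `|m| ≤ nd nΔ`,
`|B3|ρ ≤ K3`, `|B2| ≤ K2`, `|B1|/ρ ≤ K1` ⟹ `|(B3σ³ + 3B2στ + B1τ′)u + (B2σ²+B1τ)m + 2(B2σσ + B1τ)m| ≤ (K3 A³ + 3K2(A nd² + A² nd) + 6K1 nd³) nΔ`.
[folklore] -/
theorem thirdDeriv_abs_le_sharp {B1 B2 B3 K1 K2 K3 A ρ σ τ τ' u m nd nΔ : ℝ} (hρ : 0 < ρ) (hnd : 0 ≤ nd) (hnΔ : 0 ≤ nΔ) (hA : 0 ≤ A)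
    (hσ : |σ| ≤ A) (hτ0 : 0 ≤ τ) (hτ : τ ≤ nd ^ 2 / ρ) (hτ' : |τ'| ≤ 3 * nd ^ 3 / ρ ^ 2) (hu : |u| ≤ ρ * nΔ) (hm : |m| ≤ nd * nΔ)
    (hK3 : |B3| * ρ ≤ K3) (hK2 : |B2| ≤ K2) (hK1 : |B1| / ρ ≤ K1) :
    |(B3 * σ ^ 3 + 3 * B2 * σ * τ + B1 * τ') * u + (B2 * σ ^ 2 + B1 * τ) * m + 2 * (B2 * σ * σ + B1 * τ) * m| ≤
      (K3 * A ^ 3 + 3 * K2 * (A * nd ^ 2 + A ^ 2 * nd) + 6 * K1 * nd ^ 3) * nΔ := by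
  have hσ3 : |σ ^ 3| ≤ A ^ 3 := by rw [abs_pow]; exact pow_le_pow_left₀ (abs_nonneg _) hσ 3
  have hσ2 : |σ ^ 2| ≤ A ^ 2 := by rw [abs_pow]; exact pow_le_pow_left₀ (abs_nonneg _) hσ 2
  have hK1' : |B1| ≤ K1 * ρ := by rwa [div_le_iff₀ hρ] at hK1
  have hK10 : 0 ≤ K1 := le_trans (div_nonneg (abs_nonneg _) hρ.le) hK1
  have hK20 : 0 ≤ K2 := le_trans (abs_nonneg _) hK2
  have hK30 : 0 ≤ K3 := le_trans (mul_nonneg (abs_nonneg _) hρ.le) hK3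
  have h1 : |B3 * σ ^ 3 * u| ≤ K3 * A ^ 3 * nΔ := by
    rw [abs_mul, abs_mul]
    calc |B3| * |σ ^ 3| * |u| ≤ |B3| * A ^ 3 * (ρ * nΔ) := mul_le_mul (mul_le_mul_of_nonneg_left hσ3 (abs_nonneg _)) hu (abs_nonneg _) (by positivity)
      _ = |B3| * ρ * (A ^ 3 * nΔ) := by ring
      _ ≤ K3 * (A ^ 3 * nΔ) := mul_le_mul_of_nonneg_right hK3 (by positivity)
      _ = K3 * A ^ 3 * nΔ := by ring
  have h2 : |3 * B2 * σ * τ * u| ≤ 3 * K2 * A * nd ^ 2 * nΔ := by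
    rw [abs_mul, abs_mul, abs_mul, abs_mul, abs_of_pos (by norm_num : (0:ℝ) < 3), abs_of_nonneg hτ0]
    calc 3 * |B2| * |σ| * τ * |u| ≤ 3 * K2 * A * (nd ^ 2 / ρ) * (ρ * nΔ) := by gcongr
      _ = 3 * K2 * A * nd ^ 2 * nΔ := by field_simp
  have h3 : |B1 * τ' * u| ≤ 3 * K1 * nd ^ 3 * nΔ := by
    rw [abs_mul, abs_mul]
    calc |B1| * |τ'| * |u| ≤ K1 * ρ * (3 * nd ^ 3 / ρ ^ 2) * (ρ * nΔ) := by gcongr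
      _ = 3 * K1 * nd ^ 3 * nΔ := by field_simp
  have h4 : |(B2 * σ ^ 2 + B1 * τ) * m| ≤ (K2 * A ^ 2 * nd + K1 * nd ^ 3) * nΔ := by
    rw [abs_mul]
    have ha : |B2 * σ ^ 2 + B1 * τ| ≤ K2 * A ^ 2 + K1 * ρ * (nd ^ 2 / ρ) := by
      calc |B2 * σ ^ 2 + B1 * τ| ≤ |B2 * σ ^ 2| + |B1 * τ| := abs_add_le _ _
        _ ≤ K2 * A ^ 2 + K1 * ρ * (nd ^ 2 / ρ) := by
          rw [abs_mul, abs_mul, abs_of_nonneg hτ0]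
          exact add_le_add (mul_le_mul hK2 hσ2 (abs_nonneg _) hK20) (mul_le_mul hK1' hτ hτ0 (by positivity))
    have e : K2 * A ^ 2 + K1 * ρ * (nd ^ 2 / ρ) = K2 * A ^ 2 + K1 * nd ^ 2 := by field_simp
    rw [e] at ha
    calc |B2 * σ ^ 2 + B1 * τ| * |m| ≤ (K2 * A ^ 2 + K1 * nd ^ 2) * (nd * nΔ) := mul_le_mul ha hm (abs_nonneg _) (by positivity)
      _ = (K2 * A ^ 2 * nd + K1 * nd ^ 3) * nΔ := by ring
  have h5 : |2 * (B2 * σ * σ + B1 * τ) * m| ≤ 2 * ((K2 * A ^ 2 * nd + K1 * nd ^ 3) * nΔ) := by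
    have e : B2 * σ * σ + B1 * τ = B2 * σ ^ 2 + B1 * τ := by ring
    rw [e, mul_assoc, abs_mul, abs_of_pos (by norm_num : (0:ℝ) < 2)]
    exact mul_le_mul_of_nonneg_left h4 (by norm_num)
  have hsplit : (B3 * σ ^ 3 + 3 * B2 * σ * τ + B1 * τ') * u = B3 * σ ^ 3 * u + 3 * B2 * σ * τ * u + B1 * τ' * u := by ring
  rw [hsplit]
  calc |B3 * σ ^ 3 * u + 3 * B2 * σ * τ * u + B1 * τ' * u + (B2 * σ ^ 2 + B1 * τ) * m + 2 * (B2 * σ * σ + B1 * τ) * m|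
      ≤ |B3 * σ ^ 3 * u + 3 * B2 * σ * τ * u + B1 * τ' * u| + |(B2 * σ ^ 2 + B1 * τ) * m| + |2 * (B2 * σ * σ + B1 * τ) * m| := abs_add_three _ _ _
    _ ≤ (|B3 * σ ^ 3 * u| + |3 * B2 * σ * τ * u| + |B1 * τ' * u|) + |(B2 * σ ^ 2 + B1 * τ) * m| + |2 * (B2 * σ * σ + B1 * τ) * m| := by
        gcongr; exact abs_add_three _ _ _
    _ ≤ (K3 * A ^ 3 * nΔ + 3 * K2 * A * nd ^ 2 * nΔ + 3 * K1 * nd ^ 3 * nΔ) + (K2 * A ^ 2 * nd + K1 * nd ^ 3) * nΔ +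
        2 * ((K2 * A ^ 2 * nd + K1 * nd ^ 3) * nΔ) := by linarith
    _ = (K3 * A ^ 3 + 3 * K2 * (A * nd ^ 2 + A ^ 2 * nd) + 6 * K1 * nd ^ 3) * nΔ := by ring

/-- At `A = nd` the sharp constant is the isotropic one: `K3 nd³ + 3K2(nd·nd² + nd²·nd) + 6K1 nd³ = (K3 + 6K2 + 6K1) nd³`. [arithmetic] -/
theorem sharpConst_at_nd (K1 K2 K3 nd : ℝ) :
    K3 * nd ^ 3 + 3 * K2 * (nd * nd ^ 2 + nd ^ 2 * nd) + 6 * K1 * nd ^ 3 = (K3 + 6 * K2 + 6 * K1) * nd ^ 3 := by ring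

/-- The sharp constant is monotone in `A ≥ 0`. [arithmetic] -/
theorem sharpConst_mono {K1 K2 K3 nd A A' : ℝ} (hK2 : 0 ≤ K2) (hK3 : 0 ≤ K3) (hnd : 0 ≤ nd) (hA : 0 ≤ A) (hAA' : A ≤ A') :
    K3 * A ^ 3 + 3 * K2 * (A * nd ^ 2 + A ^ 2 * nd) + 6 * K1 * nd ^ 3 ≤ K3 * A' ^ 3 + 3 * K2 * (A' * nd ^ 2 + A' ^ 2 * nd) + 6 * K1 * nd ^ 3 := by
  have h3 : A ^ 3 ≤ A' ^ 3 := pow_le_pow_left₀ hA hAA' 3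
  have h2 : A ^ 2 ≤ A' ^ 2 := pow_le_pow_left₀ hA hAA' 2
  have ha : A * nd ^ 2 + A ^ 2 * nd ≤ A' * nd ^ 2 + A' ^ 2 * nd := by gcongr
  nlinarith [mul_le_mul_of_nonneg_left h3 hK3, mul_le_mul_of_nonneg_left ha hK2]

/-! ## §2. The radial component of the displacement along the path -/

/-- ★ `|σ_t| = |⟪p,d⟫ + t‖d‖²|/ρ_t ≤ (P + ‖d‖²)/a` for `t ∈ [0,1]`, `|⟪p,d⟫| ≤ P`, `0 < a ≤ ρ_t`. [folklore] -/
theorem abs_segS_le_of_inner_le {p d : EuclideanSpace ℝ (Fin 3)} {t a P : ℝ} (ha : 0 < a) (hat : a ≤ segR p d t) (ht : t ∈ Set.Icc (0 : ℝ) 1)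
    (hP : |⟪p, d⟫| ≤ P) : |segS p d t| ≤ (P + ‖d‖ ^ 2) / a := by
  have hρ : 0 < segR p d t := ha.trans_le hat
  have hN : |segN p d t| ≤ P + ‖d‖ ^ 2 := by
    rw [segN]
    calc |⟪p, d⟫ + ‖d‖ ^ 2 * t| ≤ |⟪p, d⟫| + |‖d‖ ^ 2 * t| := abs_add_le _ _
      _ ≤ P + ‖d‖ ^ 2 := by
        rw [abs_mul, abs_of_nonneg (by positivity : (0:ℝ) ≤ ‖d‖ ^ 2), abs_of_nonneg ht.1]
        have : ‖d‖ ^ 2 * t ≤ ‖d‖ ^ 2 * 1 := mul_le_mul_of_nonneg_left ht.2 (by positivity)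
        linarith
  have hP0 : 0 ≤ P + ‖d‖ ^ 2 := le_trans (abs_nonneg _) hN
  rw [segS, abs_div, abs_of_pos hρ]
  calc |segN p d t| / segR p d t ≤ (P + ‖d‖ ^ 2) / segR p d t := div_le_div_of_nonneg_right hN hρ.le
    _ ≤ (P + ‖d‖ ^ 2) / a := div_le_div_of_nonneg_left hP0 ha hat

/-- ★ The radial bound `A := min ‖d‖ ((P + ‖d‖²)/a)` is admissible: `0 ≤ A` and `|σ_t| ≤ A` on `[0,1]`. [folklore] -/
theorem abs_segS_le_min {p d : EuclideanSpace ℝ (Fin 3)} {t a P : ℝ} (ha : 0 < a) (hat : a ≤ segR p d t) (ht : t ∈ Set.Icc (0 : ℝ) 1)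
    (hP : |⟪p, d⟫| ≤ P) : |segS p d t| ≤ min ‖d‖ ((P + ‖d‖ ^ 2) / a) :=
  le_min (abs_segS_le (ha.trans_le hat)) (abs_segS_le_of_inner_le ha hat ht hP)

/-! ## §3. ★★★ The sharp two-sided third-order expansion of the slope form -/

/-- ★★★ **SHARP TWO-SIDED THIRD-ORDER EXPANSION OF THE PER-LABEL SLOPE FORM.**  Tube `a < ‖p + t d‖ < b` for `t ∈ [0,1]` (`a > 0`); on `(a, b)`:
`B′ = B₁`, `B₁′ = B₂`, `B₂′ = B₃`, `|B₃ r|·r ≤ K₃`, `|B₂ r| ≤ K₂`, `|B₁ r|/r ≤ K₁`; radial bound `|σ_t| ≤ A` (`0 ≤ A`) on `[0,1]`.  Then, with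
`σ₀ = ⟪p,d⟫/‖p‖`, the third-order remainder of `slopeForm_thirdOrder` is at most `(K₃A³ + 3K₂(A‖d‖² + A²‖d‖) + 6K₁‖d‖³)/6 · ‖Δ‖`.
[folklore: Taylor with third-order remainder; radial split] -/
theorem slopeForm_thirdOrder_sharp {B B₁ B₂ B₃ : ℝ → ℝ} {a b K₁ K₂ K₃ A : ℝ} {p d Δ : EuclideanSpace ℝ (Fin 3)} (ha : 0 < a) (hA : 0 ≤ A)
    (htube : ∀ t ∈ Set.Icc (0 : ℝ) 1, a < segR p d t ∧ segR p d t < b)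
    (hσA : ∀ t ∈ Set.Icc (0 : ℝ) 1, |segS p d t| ≤ A)
    (hB : ∀ r, a < r → r < b → HasDerivAt B (B₁ r) r) (hB₁ : ∀ r, a < r → r < b → HasDerivAt B₁ (B₂ r) r)
    (hB₂ : ∀ r, a < r → r < b → HasDerivAt B₂ (B₃ r) r)
    (hK₃ : ∀ r, a < r → r < b → |B₃ r| * r ≤ K₃) (hK₂ : ∀ r, a < r → r < b → |B₂ r| ≤ K₂) (hK₁ : ∀ r, a < r → r < b → |B₁ r| / r ≤ K₁) :
    |B ‖p + d‖ * ⟪p + d, Δ⟫ - B ‖p‖ * ⟪p, Δ⟫ - (B₁ ‖p‖ * (⟪p, d⟫ / ‖p‖) * ⟪p, Δ⟫ + B ‖p‖ * ⟪d, Δ⟫) -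
        ((B₂ ‖p‖ * (⟪p, d⟫ / ‖p‖) ^ 2 + B₁ ‖p‖ * ((‖d‖ ^ 2 - (⟪p, d⟫ / ‖p‖) ^ 2) / ‖p‖)) * ⟪p, Δ⟫ + 2 * B₁ ‖p‖ * (⟪p, d⟫ / ‖p‖) * ⟪d, Δ⟫) / 2| ≤
      (K₃ * A ^ 3 + 3 * K₂ * (A * ‖d‖ ^ 2 + A ^ 2 * ‖d‖) + 6 * K₁ * ‖d‖ ^ 3) / 6 * ‖Δ‖ := by
  set g : ℝ → ℝ := fun s => B (segR p d s) * ⟪p + s • d, Δ⟫ with hg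
  set g1 : ℝ → ℝ := fun s => B₁ (segR p d s) * segS p d s * ⟪p + s • d, Δ⟫ + B (segR p d s) * ⟪d, Δ⟫ with hg1
  set g2 : ℝ → ℝ := fun s =>
    (B₂ (segR p d s) * segS p d s ^ 2 + B₁ (segR p d s) * ((‖d‖ ^ 2 - segS p d s ^ 2) / segR p d s)) * ⟪p + s • d, Δ⟫ +
      2 * B₁ (segR p d s) * segS p d s * ⟪d, Δ⟫ with hg2
  set g3 : ℝ → ℝ := fun t =>
    (B₃ (segR p d t) * segS p d t ^ 3 + 3 * B₂ (segR p d t) * segS p d t * ((‖d‖ ^ 2 * segR p d t - segN p d t * segS p d t) / segR p d t ^ 2) +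
          B₁ (segR p d t) * ((-(2 * segS p d t * ((‖d‖ ^ 2 * segR p d t - segN p d t * segS p d t) / segR p d t ^ 2)) * segR p d t -
            (‖d‖ ^ 2 - segS p d t ^ 2) * segS p d t) / segR p d t ^ 2)) * ⟪p + t • d, Δ⟫ +
        (B₂ (segR p d t) * segS p d t ^ 2 + B₁ (segR p d t) * ((‖d‖ ^ 2 - segS p d t ^ 2) / segR p d t)) * ⟪d, Δ⟫ +
        2 * (B₂ (segR p d t) * segS p d t * segS p d t +
          B₁ (segR p d t) * ((‖d‖ ^ 2 * segR p d t - segN p d t * segS p d t) / segR p d t ^ 2)) * ⟪d, Δ⟫ with hg3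
  set L : ℝ := (K₃ * A ^ 3 + 3 * K₂ * (A * ‖d‖ ^ 2 + A ^ 2 * ‖d‖) + 6 * K₁ * ‖d‖ ^ 3) * ‖Δ‖ with hL
  have hpos : ∀ t ∈ Set.Icc (0 : ℝ) 1, 0 < segR p d t := fun t ht => ha.trans (htube t ht).1
  have hd1 : ∀ t ∈ Set.Icc (0 : ℝ) 1, HasDerivAt g (g1 t) t := fun t ht =>
    hasDerivAt_slopeForm (hpos t ht).ne' (hB _ (htube t ht).1 (htube t ht).2)
  have hd2 : ∀ t ∈ Set.Icc (0 : ℝ) 1, HasDerivAt g1 (g2 t) t := by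
    intro t ht
    have h := hasDerivAt_slopeForm_deriv (Δ := Δ) (hpos t ht).ne' (hB _ (htube t ht).1 (htube t ht).2) (hB₁ _ (htube t ht).1 (htube t ht).2)
    refine h.congr_deriv ?_
    rw [hg2]
    simp only []
    rw [segS_deriv_eq (hpos t ht).ne']
  have hd3 : ∀ t ∈ Set.Icc (0 : ℝ) 1, HasDerivAt g2 (g3 t) t := fun t ht =>
    hasDerivAt_slopeForm_deriv2 (hpos t ht).ne' (hB₁ _ (htube t ht).1 (htube t ht).2) (hB₂ _ (htube t ht).1 (htube t ht).2)
  have hbd : ∀ t ∈ Set.Icc (0 : ℝ) 1, |g3 t| ≤ L := by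
    intro t ht
    have h0 := hpos t ht
    have hτ := segS_deriv_bounds (p := p) (d := d) h0
    have hτe := segS_deriv_eq (p := p) (d := d) h0.ne'
    have hu : |⟪p + t • d, Δ⟫| ≤ segR p d t * ‖Δ‖ := by rw [segR]; exact abs_real_inner_le_norm _ _
    have hm : |⟪d, Δ⟫| ≤ ‖d‖ * ‖Δ‖ := abs_real_inner_le_norm _ _
    have key := thirdDeriv_abs_le_sharp (B1 := B₁ (segR p d t)) (B2 := B₂ (segR p d t)) (B3 := B₃ (segR p d t))
      h0 (norm_nonneg d) (norm_nonneg Δ) hA (hσA t ht) hτ.1 hτ.2 (abs_tau_deriv_le (p := p) (d := d) h0) hu hm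
      (hK₃ _ (htube t ht).1 (htube t ht).2) (hK₂ _ (htube t ht).1 (htube t ht).2) (hK₁ _ (htube t ht).1 (htube t ht).2)
    rw [hg3]
    simp only []
    rw [← hτe]
    convert key using 2
  have key := taylor3_abs hd1 hd2 hd3 hbd
  have hR0 : segR p d 0 = ‖p‖ := by simp [segR]
  have hR1 : segR p d 1 = ‖p + d‖ := by simp [segR]
  have hS0 : segS p d 0 = ⟪p, d⟫ / ‖p‖ := by simp [segS, segN, segR]
  have hg0 : g 0 = B ‖p‖ * ⟪p, Δ⟫ := by simp [hg, hR0]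
  have hgone : g 1 = B ‖p + d‖ * ⟪p + d, Δ⟫ := by simp [hg, hR1]
  have hg10 : g1 0 = B₁ ‖p‖ * (⟪p, d⟫ / ‖p‖) * ⟪p, Δ⟫ + B ‖p‖ * ⟪d, Δ⟫ := by simp [hg1, hR0, hS0]
  have hg20 : g2 0 = (B₂ ‖p‖ * (⟪p, d⟫ / ‖p‖) ^ 2 + B₁ ‖p‖ * ((‖d‖ ^ 2 - (⟪p, d⟫ / ‖p‖) ^ 2) / ‖p‖)) * ⟪p, Δ⟫ +
      2 * B₁ ‖p‖ * (⟪p, d⟫ / ‖p‖) * ⟪d, Δ⟫ := by simp [hg2, hR0, hS0]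
  rw [hg0, hgone, hg10, hg20, hL] at key
  have e : (K₃ * A ^ 3 + 3 * K₂ * (A * ‖d‖ ^ 2 + A ^ 2 * ‖d‖) + 6 * K₁ * ‖d‖ ^ 3) * ‖Δ‖ / 6 =
      (K₃ * A ^ 3 + 3 * K₂ * (A * ‖d‖ ^ 2 + A ^ 2 * ‖d‖) + 6 * K₁ * ‖d‖ ^ 3) / 6 * ‖Δ‖ := by ring
  rw [e] at key
  exact key

end Summit.AtomisticToContinuum.Crystallization.Theorems.FrustratedLawDichotomyStrainedPatchHomSlopePathThirdSharp

end
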